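/-
Copyright: cell `pub-ymgap` (HUMAN RULING D-0062), Track A of `YM-PLAN.md`, DAG node N20 (= NE7b); R134 acceleration seat
`pub-ymgap-dag-n20-c` (strategy s1, generation 4), module 25.  Released under the licence of the surrounding project.
-/
import Summits.QuantumFields.YangMills.Theorems.BalabanUVNodesN20LCSLargeFieldRootedAtZero
import HarnessLib

/-!
# YM-DAG node N20 (= NE7b), strategy s1, module 25: THE (α)-ROAD's CLASS WEIGHT BOUND FIRES AT THE RECORD for keys rooted at the first step —
# `sum_admS_integral_le_of_LCS` APPLIED: the level-`K` weight of the pattern class is at most `(m·e^{Cδ₀ − δ₀g₀⁻²ε″²∕(2N)})^{#D}` times the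
# level-`0` mass, for every label-reading tower satisfying the road's displayed rows

Track A of `YM-PLAN.md` (cell `pub-ymgap`, HUMAN RULING D-0062), node **N20** = spine estimate NE7b (`T4WeightBudget.RelWeightBound` — NOT PRINTED,
NOT PROVED).  Seat `pub-ymgap-dag-n20-c` (R134, s1 «the `LocCondStability` INSTANCE for Bałaban's tower at a pinned 𝐑𝐓 step»), generation 4, module 25
(17–24 = `…N20LCSLargeField{Labels,FirstStep,Families,Halves,OfMoments,Subfamilies,RootedAtZero}`, `…N20LCSLabelPieces`).  Kernel theorems only:
0 `def`, 0 `sorry`, standard axioms; COUNT-NEUTRAL; `--supports` the K3‴ item.  Nothing of Bałaban's is asserted.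

WHAT.  `Spine/NE7b/LocalConditionalStability.sum_admS_integral_le_of_LCS` is the (α)-road's Peierls bookkeeping: the `hstep` identities + the two
halves + the cost–volume inequality `c ≤ Σ_{j<K}(a − b)` along every pattern history ⟹ the pattern class's level-`K` weight is `≤ e^{−c}·∫ρ₀ dμ_0`.
Module 24 inhabited the two halves at every cutoff for keys ROOTED AT THE FIRST STEP (extraction at level `0`, free later levels).  THIS FILE applies
the bookkeeping theorem AT THE RECORD:
* §1 `sumAlong_rootedAtZero` (an exponent family supported at level `0` sums, along any history of positive length, to its level-`0` value);
* §2 ★★★ **`sum_admS_integral_le_of_record_rootedAtZero`** — with the `δ₀ > 0`, `C ≥ 0` of n20-d's cells Peierls bound: on every torus `F.P K`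
  (`K ≥ 1`), for `g₀⁻² ≥ 4N`, every residual fluctuation factor obeying `IsZetaUnity`, `IsZetaAbsLeOne`, `0 ≤ ζ` (displayed), every finite family `D` of
  χ₁-cubes with regularity letters on pairwise disjoint regions of at most `m ≥ 1` plaquettes and `ε″ ≥ 0`; for every cutoff `Kc + 1`, EVERY history
  tower `T` over `cfgOfRecord F N K ·` whose step kernels READ LABEL SUB-SUMS of the record at every level (`hread`; the level-`0` sets pinning `D` — the
  key is rooted at the first step) and which satisfies the road's OWN displayed rows `hstep`, `hintχ`, `hint`, `hρ₀`
  (`Support/B16HistoryTowerExtractionStepDataLWR`), every pattern `S`, level measures with `μ 0 = ∏dU`: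
  `Σ_{h ∈ admS T S (Kc+1)} ∫ eterm ρ₀ (Kc+1) h dμ_{Kc+1} ≤ (m·e^{Cδ₀ − δ₀g₀⁻²ε″²∕(2N)})^{#D} · ∫ ρ₀ dμ_0`
  — exponents `a ≡ 0`, `b 0 = log((m r)^{#D})`, `b j = 0` (`j ≥ 1`), carrier the indicator at level `0` and `1` later, `c = −log((m r)^{#D})`.
  This is END2's `extractA` SHAPE («the partial sum over the class is at most `q` times the full sum») with `q = (m·r)^{#D}` — ONE PEIERLS FACTOR PER
  PINNED CUBE, `β = g₀⁻²`-explicit, volume-uniform — for the class of histories whose FIRST step pins `D` large, at Bałaban's step weights of record.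

HONEST FRAMING.  A by-name CLOSURE of the road's bookkeeping for ONE kind of key (rooted at step 0; the (3.2) event; label-reading kernels), CONDITIONAL
on: the three ζ-letters, the per-cube regularity letters ([Balaban1985Variational] Thm 1 (p. 279), NOT asserted), and the road's displayed rows for the
INSTANCE's tower (`hstep` — module 21 proves its graph form per label, the `Tower` OBJECT with `RelLinPosHom` ops is the planners' ∕ (A1c)'s —,
`hintχ`, `hint`, `hρ₀`), plus the identification `hread` (the key pattern's kernels are label sub-sums pinning `D` at step 0 — (J2a), RR-1).  Keys
rooted at `j₀ ≥ 1`: module 22's hypothesis «LCS-j₀» ((A1c)).  NE7b NOT PRINTED ∕ NOT PROVED; (α)-instance 0∕1; N20 NOT discharged; typed 28∕28,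
discharged count untouched; one finite four-torus at fixed `ε` — NOT ℝ⁴, NOT infinite volume, NOT OS, NOT a mass gap, NOT Clay.

References: T. Bałaban, CMP 119 (1988) 243–285 [Balaban1988Convergent] ((3.2) p. 265); CMP 122 (1989) 175–202 [Balaban1989LargeFieldI] ((0.1),
(0.3)–(0.5) pp. 175–177, (1.22)–(1.28) pp. 181–183); CMP 122 (1989) 355–392 [Balaban1989LargeFieldII] ((1.79)–(1.80) pp. 383–384, p. 380 l. 13–17);
CMP 102 (1985) 277–309 [Balaban1985Variational] (Thm 1 p. 279).
-/

set_option autoImplicit false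

noncomputable section

open scoped BigOperators

namespace Summit.QuantumFields.YangMills.BalabanUVNodes.N20LCSLargeFieldClassWeight

open MeasureTheory
open Literature.MathematicalPhysics.QuantumFieldTheory.Balaban1983to89
open Literature.MathematicalPhysics.QuantumFieldTheory.Balaban1983to89.T4Continuum
open Literature.MathematicalPhysics.QuantumFieldTheory.Balaban1983to89.Node00
open Summit.QuantumFields.BalabanUV.T4Continuum.B16HistoryIndexedRepr (GoodClass)
open Summit.QuantumFields.BalabanUV.T4Continuum.B16HistoryReprChain (Tower)
open Summit.QuantumFields.BalabanUV.T4Continuum.NE7b.PrefixExtraction (admS)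
open Summit.QuantumFields.BalabanUV.T4Continuum.NE7b.LocalConditionalStability
  (LocCondStability PointwiseExtraction sumAlong sum_admS_integral_le_of_LCS)
open Summit.QuantumFields.YangMills.BalabanUVNodes.N20LCSLargeFieldRootedAtZero (halves_of_record_rootedAtZero)

/-! ## §1 The exponent families of a key rooted at the first step, summed along a history -/

section SumAlong

variable {Pat : Type}

/-- Along every history of positive length, an exponent family supported at level `0` with the constant value `x` sums to `x`. [folklore] -/
theorem sumAlong_rootedAtZero (x : ℝ) :
    ∀ (K : ℕ) (h : Fin (K + 1) → Pat), sumAlong (fun j (_ : Fin j → Pat) => if j = 0 then x else 0) (K + 1) h = x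
  | 0, h => by simp [sumAlong]
  | K + 1, h => by
      show sumAlong (fun j (_ : Fin j → Pat) => if j = 0 then x else 0) (K + 1) (Fin.init h) +
        (if K + 1 = 0 then x else 0) = x
      rw [sumAlong_rootedAtZero x K (Fin.init h), if_neg (Nat.succ_ne_zero K), add_zero]

end SumAlong

/-! ## §2 The class weight bound at the record -/

section Record

variable (F : T4Family) (N : ℕ) [NeZero N] (ν : Stage7Numerics) (M : ℕ) (p : B12.RunParams) (g : ℕ → ℝ)

/-- **THE (α)-ROAD FIRES AT THE RECORD FOR KEYS ROOTED AT THE FIRST STEP.**  With the `δ₀ > 0`, `C ≥ 0` of n20-d's cells Peierls bound: on every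
torus `F.P K` (`K ≥ 1`), for `g₀⁻² ≥ 4N`, every `E₀`, every residual fluctuation factor obeying `IsZetaUnity`, `IsZetaAbsLeOne`, `0 ≤ ζ`, every `A₁`,
every level-`0` sequence `s`, every finite family `D` of χ₁-cubes with regularity letters on pairwise disjoint regions of `1 ≤ m` plaquettes each and
`ε″ ≥ 0`; for every positive cutoff `Kc + 1`, every history tower `T` over `cfgOfRecord F N K ·` whose step kernels `χ` READ LABEL SUB-SUMS of the record
(`hread`, the level-`0` sets pinning `D`) and satisfy the (α)-road's displayed rows — `hstep` (the per-(step, choice) integral identities), `hintχ`,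
`hint`, `hρ₀` —, every pattern `S` and level measures with `μ 0 = ∏dU`:
THE LEVEL-`(Kc+1)` WEIGHT OF THE PATTERN CLASS IS AT MOST `(m·e^{Cδ₀ − δ₀g₀⁻²ε″²∕(2N)})^{#D}` TIMES THE LEVEL-`0` MASS,
`Σ_{h ∈ admS T S (Kc+1)} ∫ eterm ρ₀ (Kc+1) h dμ_{Kc+1} ≤ (m·r)^{#D} · ∫ ρ₀ dμ_0`
— `LocalConditionalStability.sum_admS_integral_le_of_LCS` with module 24's two halves (exponents `a = 0`, `b 0 = log((m r)^{#D})`, free later levels)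
and the cost–volume constant `c = −#D·log(m·r)`: the Peierls bookkeeping «extracted cost beats the volume cost» CLOSED AT THE RECORD for this class,
modulo the displayed letters and rows. [folklore] -/
theorem sum_admS_integral_le_of_record_rootedAtZero :
    ∃ δ₀ : ℝ, 0 < δ₀ ∧ ∃ C : ℝ, 0 ≤ C ∧ ∀ (_hK : 1 ≤ p.K) (g₀ E₀ : ℝ), 4 * N ≤ g₀⁻¹ ^ 2 →
      ∀ (A₁ : ℝ) {ζ : ZetaOfRecord F N ν M}, IsZetaUnity F N ν M ζ → IsZetaAbsLeOne F N ν M ζ →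
        (∀ q g' k' (s : SeqOfRecord F ν M g' q.K k') Pl Ql RS U V', 0 ≤ ζ q g' k' s Pl Ql RS U V') →
      ∀ (s : SeqOfRecord F ν M g p.K 0) (D : Finset (Iχ F ν p g 0)) (R : Iχ F ν p g 0 → Finset (Plaq (F.P p.K) 1))
        (m : ℕ) (ε'' : ℝ), 0 ≤ ε'' → 1 ≤ m → (∀ c ∈ D, (R c).card ≤ m) →
        (∀ c₁ ∈ D, ∀ c₂ ∈ D, c₁ ≠ c₂ → Disjoint (R c₁) (R c₂)) →
        (∀ c ∈ D, ∀ V' : GaugeField (F.P p.K) 1 (SU N),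
          (∀ p' ∈ R c, dist1 (GaugeField.plaqHol V' p') < ε'') → chiFactor F N ν p g 0 c V' = 1) →
      ∀ (Kc : ℕ) {Pat : Type} [DecidableEq Pat] {𝒢 : (j : ℕ) → GoodClass (cfgOfRecord F N p.K j)}
        (T : Tower Pat (fun j => cfgOfRecord F N p.K j) 𝒢) (S : (j : ℕ) → (Fin j → Pat) → Finset Pat)
        (μ : (j : ℕ) → Measure (cfgOfRecord F N p.K j))
        (χ : (j : ℕ) → (Fin j → Pat) → Pat → cfgOfRecord F N p.K j → ℝ)
        (sq : (j : ℕ) → (Fin j → Pat) → SeqOfRecord F ν M g p.K j) (E : (j : ℕ) → (Fin j → Pat) → Finset (LbOfRecord F ν p g j)),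
        sq 0 = (fun _ => s) →
        (∀ h t, t ∈ E 0 h → D ⊆ t.1) →
        μ 0 = fieldMeasure (F.P p.K) 0 (SU N) →
        (∀ (j : ℕ) (h : Fin j → Pat) (U : cfgOfRecord F N p.K j), ∑ q ∈ T.branch j h ∩ S j h, χ j h q U =
          ∑ t ∈ E j h, ωOfRecord F N ν M p g j A₁ ζ (sq j h) t U ((avOfRecord F N p.K j).avg U)) →
        (∀ j h, j < Kc + 1 → h ∈ admS T S j → ∀ q ∈ T.branch j h, ∀ f : cfgOfRecord F N p.K j → ℝ, (𝒢 j).Gd f →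
          ∫ x, (T.op j h q).T f x ∂μ (j + 1) = ∫ y, χ j h q y * f y ∂μ j) →
        (∀ j h, j < Kc + 1 → h ∈ admS T S j → ∀ q ∈ T.branch j h,
          Integrable (fun y => χ j h q y * T.eterm (rhoZeroOfRecord F N p.K g₀ E₀) j h y) (μ j)) →
        (∀ (j : ℕ) (h : Fin j → Pat), 1 ≤ j → j < Kc + 1 → h ∈ admS T S j →
          Integrable (T.eterm (rhoZeroOfRecord F N p.K g₀ E₀) j h) (μ j)) →
        (𝒢 0).Gd (rhoZeroOfRecord F N p.K g₀ E₀) →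
        ∑ h ∈ admS T S (Kc + 1), ∫ x, T.eterm (rhoZeroOfRecord F N p.K g₀ E₀) (Kc + 1) h x ∂μ (Kc + 1) ≤
          ((m : ℝ) * Real.exp (C * δ₀ - δ₀ * g₀⁻¹ ^ 2 * (ε'' ^ 2 / (2 * (Fintype.card (Fin N) : ℝ))))) ^ D.card *
            ∫ x, rhoZeroOfRecord F N p.K g₀ E₀ x ∂μ 0 := by
  obtain ⟨δ₀, hδ₀, C, hC, h⟩ := halves_of_record_rootedAtZero F N ν M p g
  refine ⟨δ₀, hδ₀, C, hC, fun hK g₀ E₀ hg A₁ ζ hζu hζ hζ0 s D R m ε'' hε hm1 hm hdisj hreg Kc Pat _ 𝒢 T S μ χ sq E hsq hE0 hμ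
    hread hstep hintχ hint hρ => ?_⟩
  -- the Peierls factor of the class
  set r : ℝ := ((m : ℝ) * Real.exp (C * δ₀ - δ₀ * g₀⁻¹ ^ 2 * (ε'' ^ 2 / (2 * (Fintype.card (Fin N) : ℝ))))) ^ D.card with hr
  have hrpos : 0 < r := pow_pos (mul_pos (by exact_mod_cast hm1) (Real.exp_pos _)) _
  -- the exponent families of a key rooted at step 0: `a ≡ 0`, `b 0 = log r`, `b j = 0` (`j ≥ 1`); the carrier is the indicator at level 0, `1` later
  let a : (j : ℕ) → (Fin j → Pat) → ℝ := fun _ _ => 0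
  let b : (j : ℕ) → (Fin j → Pat) → ℝ := fun j _ => if j = 0 then Real.log r else 0
  let Mc : (j : ℕ) → (Fin j → Pat) → cfgOfRecord F N p.K j → ℝ := fun j _ =>
    if hj : j = 0 then fun U => Real.exp 0 * Set.indicator {U : GaugeField (F.P p.K) 0 (SU N) |
        ∀ c ∈ D, ∃ p' ∈ R c, ε'' ≤ dist1 (GaugeField.plaqHol ((avOfRecord F N p.K 0).avg U) p')} (fun _ => (1 : ℝ)) (hj ▸ U)
    else fun _ => 1
  have hhalves := h hK g₀ E₀ hg A₁ hζu hζ hζ0 s D R m ε'' hε hm hdisj hreg (Kc + 1) T S μ χ Mc a b sq E hsq hE0 hμ hread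
    (fun gh U => by simp [Mc, a]) (fun j gh hj => by
      have hj0 : j ≠ 0 := by omega
      simp [Mc, hj0])
    (fun gh => by
      show Real.exp 0 * r ≤ Real.exp (if (0 : ℕ) = 0 then Real.log r else 0)
      rw [Real.exp_zero, one_mul, if_pos rfl, Real.exp_log hrpos])
    (fun j gh hj => by
      have hj0 : j ≠ 0 := by omega
      simp [a, b, hj0])
    hint hρ
  obtain ⟨hPE, hLCS⟩ := hhalves
  have hcost : ∀ h' ∈ admS T S (Kc + 1), -Real.log r ≤ sumAlong a (Kc + 1) h' - sumAlong b (Kc + 1) h' := by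
    intro h' _
    have ha : sumAlong a (Kc + 1) h' = 0 := by
      have := sumAlong_rootedAtZero (Pat := Pat) 0 Kc h'
      simpa [a] using this
    have hb : sumAlong b (Kc + 1) h' = Real.log r := sumAlong_rootedAtZero (Pat := Pat) (Real.log r) Kc h'
    rw [ha, hb]
    simp
  have key := sum_admS_integral_le_of_LCS (T := T) (S := S) (μ := μ) (K := Kc + 1) hρ
    (fun x => (rhoZeroOfRecord_pos F N p.K g₀ E₀ x).le) hstep hintχ hPE hLCS hcost
  rwa [neg_neg, Real.exp_log hrpos] at key

end Record

end Summit.QuantumFields.YangMills.BalabanUVNodes.N20LCSLargeFieldClassWeight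

end
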